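import Mathlib.FieldTheory.RatFunc.AsPolynomial
import Mathlib.FieldTheory.IntermediateField.Adjoin.Algebra
import Mathlib.FieldTheory.IntermediateField.Adjoin.Basic
import Mathlib.RingTheory.Algebraic.Integral
import Literature.AnabelianGeometry.AbsoluteAnabelian.AbsTopIII.KummerFaithful
import HarnessLib

/-!
# [AbsTopIII] Rmk. 1.5.4 (i), "restricting to closed points": induction on the transcendence degree

Proof-only companion (no new definitions; Mathlib field theory only) to `AbsTopIII/KummerFaithful.lean`
(S. Mochizuki, *Topics in Absolute Anabelian Geometry III*, §1, Rmk. 1.5.4 (i) p. 33): "one reduces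
immediately [...] to the case where `k` is a finitely generated extension of an MLF [...]. Then by
restricting to various closed points of this variety, one reduces to the case where `k` itself is an
MLF."  The route of record for the last open part of FACT-LIST row F-0369
(HOME/staging/f/f-083/g2/F0369-FG-ROUTE.md) runs this as an induction on the transcendence degree that
only ever uses CURVES: a finitely generated, non-algebraic extension `L` of `K₀` is a finite extension
of a rational function field `L₀(X)` with `L₀` finitely generated "of transcendence degree one less",
and the closed points of the Dedekind model of `L` over `L₀[X]` (junction J-a,
`KummerFaithfulCurveDedekindProofs.lean`) have residue fields FINITE over `L₀`.  This file proves the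
WRAPPER (memo step 8) turning the one-step reduction into a statement about all finitely generated
extensions:

* `essFiniteType_curve_induction` — for a predicate `Q` on field extensions of `K₀` (in a fixed
  universe), if `Q` holds for FINITE extensions of `K₀`, and `Q L` holds whenever `L` is finite over
  a rational function field `RatFunc L₀` (with the `L₀[X]`-, `RatFunc L₀`- and `L₀`-algebra structures
  and scalar towers junction J-a consumes) over a finitely generated `L₀/K₀` all of whose FINITE
  extensions `κ` satisfy `Q κ`, then `Q L` for every finitely generated (`Algebra.EssFiniteType`)
  extension `L/K₀`;
* `fg_curve_induction` — the same with the hypothesis spelled `(⊤ : IntermediateField K₀ L).FG`, as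
  in `Rmk_1_5_4_i_of_abelianVariety_clause_fg`.

The induction is on the size of a finite set `t ⊆ L` with `L` algebraic over `K₀(t)` (no transcendence
bases are needed): removing `a ∈ t`, either `a` is algebraic over `L₀ = K₀(t ∖ {a})` — then `L` is
algebraic over `L₀` and the set shrinks — or `a` is transcendental over `L₀`, and then
`L₀(a) ≅ RatFunc L₀` (Mathlib `RatFunc.algEquivOfTranscendental`) and `L`, being finitely generated and
algebraic over `L₀(a)`, is finite over it (`Algebra.finite_of_essFiniteType_of_isAlgebraic`); a field
finite over `L₀` is generated over `K₀` by the image of `t ∖ {a}` up to an algebraic extension.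
Classical field theory; nothing here bears on [IUTchIII] Cor. 3.12; typed ≠ discharged.
-/

noncomputable section

open scoped Classical Polynomial IntermediateField

namespace Literature.AnabelianGeometry.AbsoluteAnabelian.AbsTopIII

universe u

open Polynomial IntermediateField

section Transfer

variable {K₀ : Type u} [Field K₀] {L : Type u} [Field L] [Algebra K₀ L]

/-- Algebraicity of `L` over an intermediate field passes to any larger intermediate field. Routine.
[cite: MochizukiAbsTopIII2015, Rmk 1.5.4 (i) p.33] -/
theorem isAlgebraic_of_le_intermediateField {M₁ M₂ : IntermediateField K₀ L} (h : M₁ ≤ M₂)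
    [Algebra.IsAlgebraic M₁ L] : Algebra.IsAlgebraic M₂ L := by
  let f : M₁ →+* M₂ :=
    { toFun := fun x => ⟨x.1, h x.2⟩
      map_one' := rfl
      map_mul' := fun _ _ => rfl
      map_zero' := rfl
      map_add' := fun _ _ => rfl }
  have hf : Function.Injective f := fun x y hxy => by
    have h' := congrArg Subtype.val hxy
    exact Subtype.ext h'
  exact Algebra.IsAlgebraic.ringHom_of_comp_eq f (RingHom.id L) hf Function.surjective_id
    (RingHom.ext fun _ => rfl)

/-- `L` is algebraic over the top intermediate field. Routine. [cite: MochizukiAbsTopIII2015, Rmk 1.5.4 (i) p.33] -/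
theorem isAlgebraic_top_intermediateField : Algebra.IsAlgebraic (⊤ : IntermediateField K₀ L) L := by
  rw [Algebra.isAlgebraic_iff_isIntegral]
  exact Algebra.isIntegral_of_surjective (topEquiv (F := K₀) (E := L)).surjective

/-- If `L` is algebraic over the bottom intermediate field `⊥ = K₀`, it is algebraic over `K₀`.
Routine. [cite: MochizukiAbsTopIII2015, Rmk 1.5.4 (i) p.33] -/
theorem isAlgebraic_of_isAlgebraic_bot [Algebra.IsAlgebraic (⊥ : IntermediateField K₀ L) L] :
    Algebra.IsAlgebraic K₀ L := by
  refine Algebra.IsAlgebraic.of_ringHom_of_comp_eq (R := K₀) (S := (⊥ : IntermediateField K₀ L))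
    (A := L) (B := L) (algebraMap K₀ (⊥ : IntermediateField K₀ L)) (RingHom.id L) ?_
    Function.injective_id ?_
  · intro y
    exact ⟨botEquiv K₀ L y, by rw [← botEquiv_symm]; exact (botEquiv K₀ L).symm_apply_apply y⟩
  · ext x
    exact (IsScalarTower.algebraMap_apply K₀ (⊥ : IntermediateField K₀ L) L x).symm

end Transfer

section Step

variable {K₀ : Type u} [Field K₀] {L : Type u} [Field L] [Algebra K₀ L]

/-- For `t ⊆ L`, `a ∈ L` and `L₀ = K₀(t ∖ {a})`: if `L` is algebraic over `K₀(t)` then `L` is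
algebraic over `L₀(a)` (which contains `K₀(t)`). Routine. [cite: MochizukiAbsTopIII2015, Rmk 1.5.4 (i) p.33] -/
theorem isAlgebraic_adjoin_erase_adjoin (t : Finset L) (a : L)
    [Algebra.IsAlgebraic (adjoin K₀ (t : Set L)) L] :
    Algebra.IsAlgebraic (adjoin (adjoin K₀ ((t.erase a : Finset L) : Set L)) ({a} : Set L)) L := by
  set L₀ := adjoin K₀ ((t.erase a : Finset L) : Set L) with hL₀
  set La := adjoin (↥L₀) ({a} : Set L) with hLa
  -- `K₀(t) ≤ L₀(a)` as intermediate fields over `K₀`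
  have hle : adjoin K₀ (t : Set L) ≤ La.restrictScalars K₀ := by
    rw [hLa, restrictScalars_adjoin]
    refine adjoin.mono K₀ _ _ fun x hx => ?_
    by_cases hxa : x = a
    · exact Or.inr (by simp [hxa])
    · exact Or.inl (subset_adjoin K₀ _ (by simp [hxa, Finset.mem_coe.mp hx]))
  let f : adjoin K₀ (t : Set L) →+* La :=
    { toFun := fun x => ⟨x.1, hle x.2⟩
      map_one' := rfl
      map_mul' := fun _ _ => rfl
      map_zero' := rfl
      map_add' := fun _ _ => rfl }
  have hf : Function.Injective f := fun x y hxy => by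
    have h' := congrArg Subtype.val hxy
    exact Subtype.ext h'
  exact Algebra.IsAlgebraic.ringHom_of_comp_eq f (RingHom.id L) hf Function.surjective_id
    (RingHom.ext fun _ => rfl)

/-- For `t ⊆ L` and `a ∈ L` ALGEBRAIC over `L₀ = K₀(t ∖ {a})`: if `L` is algebraic over `K₀(t)` then
already over `L₀` (transitivity through `L₀(a)`). Routine. [cite: MochizukiAbsTopIII2015, Rmk 1.5.4 (i) p.33] -/
theorem isAlgebraic_adjoin_erase_of_isAlgebraic (t : Finset L) (a : L)
    [Algebra.IsAlgebraic (adjoin K₀ (t : Set L)) L]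
    (halg : IsAlgebraic (adjoin K₀ ((t.erase a : Finset L) : Set L)) a) :
    Algebra.IsAlgebraic (adjoin K₀ ((t.erase a : Finset L) : Set L)) L := by
  set L₀ := adjoin K₀ ((t.erase a : Finset L) : Set L) with hL₀
  haveI : Algebra.IsAlgebraic (↥L₀) (↥(adjoin (↥L₀) ({a} : Set L))) :=
    isAlgebraic_adjoin_simple halg.isIntegral
  haveI := isAlgebraic_adjoin_erase_adjoin (K₀ := K₀) t a
  exact Algebra.IsAlgebraic.trans (↥L₀) (↥(adjoin (↥L₀) ({a} : Set L))) L

/-- A field `κ` FINITE over `L₀ = K₀(s)` (`s ⊆ L` finite) is algebraic over `K₀(s')`, `s'` the image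
of `s` in `κ` — so it is again "generated by at most `#s` elements up to an algebraic extension"
(for the residue fields at closed points, which are finite over `L₀`). Routine.
[cite: MochizukiAbsTopIII2015, Rmk 1.5.4 (i) p.33] -/
theorem exists_finset_isAlgebraic_of_finite (L₀ : IntermediateField K₀ L) (s : Finset L)
    (hs : adjoin K₀ (s : Set L) = L₀) (κ : Type u) [Field κ] [Algebra K₀ κ] [Algebra L₀ κ]
    [IsScalarTower K₀ L₀ κ] [FiniteDimensional L₀ κ] :
    ∃ s' : Finset κ, s'.card ≤ s.card ∧ Algebra.IsAlgebraic (adjoin K₀ (s' : Set κ)) κ := by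
  have hsub : (s : Set L) ⊆ (L₀ : Set L) := fun x hx => hs ▸ subset_adjoin K₀ (s : Set L) hx
  -- the generators of `L₀`, as elements of `L₀`, and their images in `κ`
  have hs₀val : Subtype.val '' ((s.subtype (· ∈ L₀) : Finset L₀) : Set L₀) = (s : Set L) := by
    ext x
    simp only [Set.mem_image, Finset.mem_coe, Finset.mem_subtype, Subtype.exists,
      exists_and_right, exists_eq_right]
    exact ⟨fun ⟨_, hx⟩ => hx, fun hx => ⟨hsub hx, hx⟩⟩
  have htop : adjoin K₀ ((s.subtype (· ∈ L₀) : Finset L₀) : Set L₀) = ⊤ := by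
    apply lift_injective L₀
    rw [lift_adjoin, lift_top, hs₀val, hs]
  refine ⟨(s.subtype (· ∈ L₀)).image (IsScalarTower.toAlgHom K₀ L₀ κ), ?_, ?_⟩
  · calc ((s.subtype (· ∈ L₀)).image (IsScalarTower.toAlgHom K₀ L₀ κ)).card
        ≤ (s.subtype (· ∈ L₀)).card := Finset.card_image_le
      _ ≤ s.card := Finset.card_le_card_of_injOn Subtype.val
          (fun x hx => Finset.mem_subtype.mp hx) Set.injOn_subtype_val
  · -- `K₀(image) = range (L₀ → κ)`, and `κ` is algebraic over `L₀`
    have hrange : adjoin K₀ (((s.subtype (· ∈ L₀)).image (IsScalarTower.toAlgHom K₀ L₀ κ) :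
        Finset κ) : Set κ) = (IsScalarTower.toAlgHom K₀ L₀ κ).fieldRange := by
      rw [Finset.coe_image, ← adjoin_map, htop, AlgHom.fieldRange_eq_map]
    haveI : Algebra.IsAlgebraic L₀ κ := Algebra.IsAlgebraic.of_finite L₀ κ
    let f : L₀ →+* (IsScalarTower.toAlgHom K₀ L₀ κ).fieldRange :=
      { toFun := fun x => ⟨IsScalarTower.toAlgHom K₀ L₀ κ x, ⟨x, rfl⟩⟩
        map_one' := Subtype.ext (map_one _)
        map_mul' := fun x y => Subtype.ext (map_mul _ x y)
        map_zero' := Subtype.ext (map_zero _)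
        map_add' := fun x y => Subtype.ext (map_add _ x y) }
    have hf : Function.Injective f := fun x y hxy => by
      have h' := congrArg Subtype.val hxy
      exact (IsScalarTower.toAlgHom K₀ L₀ κ).toRingHom.injective h'
    rw [hrange]
    exact Algebra.IsAlgebraic.ringHom_of_comp_eq f (RingHom.id κ) hf Function.surjective_id
      (RingHom.ext fun _ => rfl)

end Step

section Main

variable {K₀ : Type u} [Field K₀]

/- The one-step reduction ("restrict to the closed points of a curve over `L₀`") is the hypothesis
`step` below: for a finitely generated `L₀/K₀` all of whose FINITE extensions `κ` satisfy `Q`, every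
`L` FINITE over the rational function field `RatFunc L₀` — with the `L₀[X]`-, `RatFunc L₀`- and
`L₀`-algebra structures and scalar towers of `KummerFaithfulCurveDedekindProofs.lean` (junction J-a) —
satisfies `Q`. -/
variable (Q : ∀ (E : Type u) [Field E] [Algebra K₀ E], Prop)
  (base : ∀ (E : Type u) [Field E] [Algebra K₀ E] [FiniteDimensional K₀ E], Q E)
  (step : ∀ (L₀ : Type u) [Field L₀] [Algebra K₀ L₀] [Algebra.EssFiniteType K₀ L₀],
    (∀ (κ : Type u) [Field κ] [Algebra K₀ κ] [Algebra L₀ κ] [IsScalarTower K₀ L₀ κ]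
        [FiniteDimensional L₀ κ], Q κ) →
      ∀ (L : Type u) [Field L] [Algebra K₀ L] [Algebra.EssFiniteType K₀ L] [Algebra L₀ L]
        [IsScalarTower K₀ L₀ L] [Algebra L₀[X] L] [Algebra (RatFunc L₀) L]
        [IsScalarTower L₀[X] (RatFunc L₀) L] [IsScalarTower L₀ L₀[X] L]
        [IsScalarTower L₀ (RatFunc L₀) L] [FiniteDimensional (RatFunc L₀) L], Q L)

include base step in
/-- The induction engine: `Q L` for every finitely generated `L/K₀` algebraic over `K₀(t)` for a finite
`t ⊆ L`, by induction on `#t` (see the module docstring). [cite: MochizukiAbsTopIII2015, Rmk 1.5.4 (i) p.33] -/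
theorem curve_induction_aux (n : ℕ) :
    ∀ (L : Type u) [Field L] [Algebra K₀ L] [Algebra.EssFiniteType K₀ L] (t : Finset L),
      t.card ≤ n → Algebra.IsAlgebraic (adjoin K₀ (t : Set L)) L → Q L := by
  induction n with
  | zero =>
    intro L _ _ _ t ht halg
    have ht0 : t = ∅ := Finset.card_eq_zero.mp (Nat.le_zero.mp ht)
    subst ht0
    rw [Finset.coe_empty, adjoin_empty] at halg
    haveI : Algebra.IsAlgebraic K₀ L := isAlgebraic_of_isAlgebraic_bot
    haveI : Module.Finite K₀ L := Algebra.finite_of_essFiniteType_of_isAlgebraic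
    exact base L
  | succ n ih =>
    intro L _ _ _ t ht halg
    -- `t = ∅` is the base case again
    by_cases hte : t = ∅
    · exact ih L t (by simp [hte]) halg
    obtain ⟨a, ha⟩ := Finset.nonempty_iff_ne_empty.mpr hte
    have hcard : (t.erase a).card ≤ n := by
      rw [Finset.card_erase_of_mem ha]; omega
    set L₀ := adjoin K₀ ((t.erase a : Finset L) : Set L) with hL₀
    haveI : Algebra.EssFiniteType K₀ L₀ := essFiniteType_iff.mpr (fg_adjoin_finset _)
    by_cases halga : IsAlgebraic L₀ a
    · -- `a` algebraic over `L₀`: drop it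
      exact ih L (t.erase a) hcard (isAlgebraic_adjoin_erase_of_isAlgebraic t a halga)
    -- `a` transcendental over `L₀`: `L` is finite over `L₀(a) ≅ RatFunc L₀`
    have htr : Transcendental L₀ a := halga
    set La := adjoin (↥L₀) ({a} : Set L) with hLa
    haveI : Algebra.IsAlgebraic La L := isAlgebraic_adjoin_erase_adjoin t a
    set e : RatFunc L₀ ≃ₐ[L₀] La := RatFunc.algEquivOfTranscendental a htr with he
    letI : Algebra (RatFunc L₀) L := ((algebraMap La L).comp (e : RatFunc L₀ →+* La)).toAlgebra
    letI : Algebra L₀[X] L :=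
      ((algebraMap (RatFunc L₀) L).comp (algebraMap L₀[X] (RatFunc L₀))).toAlgebra
    haveI : IsScalarTower L₀[X] (RatFunc L₀) L := IsScalarTower.of_algebraMap_eq fun _ => rfl
    haveI hT : IsScalarTower L₀ (RatFunc L₀) L := by
      refine IsScalarTower.of_algebraMap_eq fun c => ?_
      change algebraMap L₀ L c = algebraMap La L (e (algebraMap L₀ (RatFunc L₀) c))
      rw [e.commutes, ← IsScalarTower.algebraMap_apply]
    haveI : IsScalarTower L₀ L₀[X] L := by
      refine IsScalarTower.of_algebraMap_eq fun c => ?_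
      rw [IsScalarTower.algebraMap_apply L₀ (RatFunc L₀) L,
        IsScalarTower.algebraMap_apply L₀ L₀[X] (RatFunc L₀)]
      rfl
    haveI : IsScalarTower K₀ (RatFunc L₀) L := by
      refine IsScalarTower.of_algebraMap_eq fun c => ?_
      rw [IsScalarTower.algebraMap_apply K₀ L₀ (RatFunc L₀), ← IsScalarTower.algebraMap_apply L₀,
        ← IsScalarTower.algebraMap_apply]
    -- `L` is finite over `RatFunc L₀`
    letI : Algebra (RatFunc L₀) La := (e : RatFunc L₀ →+* La).toAlgebra
    haveI : IsScalarTower (RatFunc L₀) La L := IsScalarTower.of_algebraMap_eq fun _ => rfl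
    haveI : Algebra.IsAlgebraic (RatFunc L₀) La :=
      ⟨fun y => by
        obtain ⟨z, rfl⟩ := e.surjective y
        exact isAlgebraic_algebraMap (R := RatFunc L₀) (A := ↥La) z⟩
    haveI : Algebra.IsAlgebraic (RatFunc L₀) L := Algebra.IsAlgebraic.trans (RatFunc L₀) La L
    haveI : Algebra.EssFiniteType (RatFunc L₀) L := Algebra.EssFiniteType.of_comp K₀ (RatFunc L₀) L
    haveI : Module.Finite (RatFunc L₀) L := Algebra.finite_of_essFiniteType_of_isAlgebraic
    -- the induction hypothesis covers the finite extensions of `L₀`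
    refine step L₀ (fun κ _ _ _ _ _ => ?_) L
    haveI : Algebra.EssFiniteType L₀ κ := inferInstance
    haveI : Algebra.EssFiniteType K₀ κ := Algebra.EssFiniteType.comp K₀ L₀ κ
    obtain ⟨s', hs', halg'⟩ := exists_finset_isAlgebraic_of_finite L₀ (t.erase a) hL₀.symm κ
    exact ih κ s' (hs'.trans hcard) halg'

include base step in
/-- **Induction on the transcendence degree through curves** ([AbsTopIII] Rmk. 1.5.4 (i), "by
restricting to various closed points of this variety, one reduces to the case where `k` itself is an
MLF" — made into an induction that only uses curves): let `Q` be a property of field extensions of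
`K₀`. If `Q` holds for every FINITE extension of `K₀`, and `Q L` holds whenever `L` is finite over a
rational function field `RatFunc L₀` over a finitely generated `L₀/K₀` all of whose finite extensions
satisfy `Q` (hypothesis `step`), then `Q L` for EVERY finitely generated extension `L/K₀`.
[cite: MochizukiAbsTopIII2015, Rmk 1.5.4 (i) p.33] -/
theorem essFiniteType_curve_induction (L : Type u) [Field L] [Algebra K₀ L]
    [Algebra.EssFiniteType K₀ L] : Q L := by
  obtain ⟨s, hs⟩ := fg_top K₀ L
  haveI : Algebra.IsAlgebraic (adjoin K₀ (s : Set L)) L := by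
    rw [hs]; exact isAlgebraic_top_intermediateField
  exact curve_induction_aux Q base step s.card L s le_rfl ‹_›

include base step in
/-- `essFiniteType_curve_induction` with "finitely generated" spelled `(⊤ : IntermediateField K₀ L).FG`
(Mathlib `IntermediateField.fg_top_iff`), the spelling of `Rmk_1_5_4_i_of_abelianVariety_clause_fg`.
[cite: MochizukiAbsTopIII2015, Rmk 1.5.4 (i) p.33] -/
theorem fg_curve_induction (L : Type u) [Field L] [Algebra K₀ L]
    (hL : (⊤ : IntermediateField K₀ L).FG) : Q L := by
  haveI := fg_top_iff.mp hL
  exact essFiniteType_curve_induction Q base step L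

end Main

end Literature.AnabelianGeometry.AbsoluteAnabelian.AbsTopIII

end
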